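import Summits.HodgeConjecture.CorCM.Census.CoinvariantTwoGroups
import Summits.HodgeConjecture.CorCM.Census.CoinvariantCyclic
import Summits.HodgeConjecture.CorCM.FaceParityFloor
import Summits.HodgeConjecture.CorCM.CM.Lemmas
import HarnessLib

/-!
# The face-COINVARIANT floor: a set of faces of a Galois CM field whose Weil characters generate those of all faces has at least
# `φ₂(F) = dim_𝔽₂ (Λ_F ⊗ 𝔽₂)_{Gal}` members, and `φ₂(F) ≥ β(F) − 1 − δ(F)`

COR-CM (cell `pub-hodgecm2`), count-neutral kernel combinatorics by the binder seat b09 (gen 29; lane COINVARIANT-FLOOR),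
part IV: the intrinsic form, for a Galois CM field `F`, of `Census/CoinvariantFibre.lean` (I), `Census/CoinvariantFloor.lean` (II),
`Census/CoinvariantTwoGroups.lean` (III) and `Census/CoinvariantCyclic.lean` (VI); sibling of the parity floor `CorCM/FaceParityFloor.lean` (gen 28) and the rank floor
`CorCM/FaceBasisFloor.lean` (gen 27).  Theorems only; no `decide`, no certificate, no named fact, no `sorry`; `Interfaces.lean` (C1),
every E term, B01, `Transposition/*` untouched.  HONEST FRAMING: `HC_CM` is NOT proved, here or anywhere in the tree; nothing here is
a period.  T5: n/a-class — the one Prop binder is the generation binder `hgen(𝒮, σ₀)` of INT2-GEN (`CorCM/FacePeriodsGeneratingSet.lean`),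
inhabited by `FaceBasis.basisFace_hgen`; no named-fact / conjecture-def binder; checker: self (prover-pub-hodgecm2-b09-g29-0), 2026-08-22.

SETTING.  `F` a Galois CM field, `G = GalT F`, `c = conjT` (central), abstract CM types `CMF (GalT F) conjT`, the `σ`-reads
`weightRel g.corner (fun _ ↦ {σ})` of the rank-four faces `g : Face F` and their Lefschetz characters (`CorCM/CM/LefschetzChar1.lean`).
`φ₂(F) := fibreTwo conjT conjT_mul_self` is the coinvariant fibre of part I for `(GalT F, conjT)`: the `𝔽₂`-dimension of the lattice
`Λ_F` of integer Hodge vectors modulo pairs, tensored with `𝔽₂` and taken modulo the Galois coboundaries — André-3's `fibre₂(F)`.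
* §1 DICTIONARY: the pair relations of `F` are the pairs of part I (`pairRel_eq_span_pairSet`), and every `σ`-read of a face is an
  integer HODGE vector — its type sum is the constant `2` (`typeSum_weightRel_corner`, rfwf Lemma 1.2 `sumTwo_corner`), hence it lies
  in `hodgeSpan = ℤ⟨faces⟩ + ℤ⟨pairs⟩` (`weightRel_corner_mem_hodgeSpan`, via the prior programme's `gfaces_generate`).
* §2 **THE FACE-COINVARIANT FLOOR** (`fibreTwo_le_card_of_hgen`): for every finite `𝒮 ⊆ Face F` with `hgen(𝒮, σ₀)`:
  **`φ₂(F) ≤ |𝒮|`** — no census, no certificate, every degree and every Galois type.  With §3 and gen 27/28: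
  `max(φ₂(F), ⌈(2^{n−1} − n)/n⌉) ≤ min |𝒮| ≤ 2^{n−1} − n` and `φ₂(F) ≥ β(F) − 1 − δ(F)`, for EVERY Galois CM field of degree `2n`.
  Numerically (André-3 PORTFOLIO-g15 §0 (D), gen 28 `fibre*.py`) `φ₂` EQUALS André-3's `μ` on every Galois CM type of order `≤ 20`
  (and is the larger floor on every «divided parity» row: `Q₈ 2`, `Q₁₆ 16`, `SD₁₆ 19`, `M₁₆ 17`, `ℤ/4×ℤ/2 (c ∈ 2G) 2`, …).
* §3 **DOMINATION** (`card_block_le_fibreTwo_add`): `β(F) ≤ φ₂(F) + 1 + δ(F)` — the parity floor of `FaceParityFloor` follows from the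
  coinvariant floor.
* §4 **`2`-POWER DEGREE** (`exists_faces_generate_of_finrank_eq_two_pow`): if `[F:ℚ] = 2^k` then `GalT F` is a `2`-group and
  `φ₂(F)` abstract faces GENERATE the Hodge lattice of `F` mod `2` modulo pairs under base change (part III, Nakayama) — the mod-`2`
  law `μ₂ = μ_{F,2} = fibre₂` for every Galois CM field of `2`-power degree.
* §5 **CYCLIC GALOIS GROUP** (`fibreTwo_add_one_eq_card_block_of_isCyclic`, `fibreTwo_add_one_mul_finrank_of_isCyclic`): if `GalT F`
  is cyclic (`ℚ(ζ_{p^k})`, every cyclic CM field) then **`φ₂(F) = β(F) − 1`** EXACTLY and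
  `(φ₂(F) + 1)·[F:ℚ] = Σ_{d ∣ [F:ℚ], d odd} φ(d)·2^{[F:ℚ]/(2d)}` (part VI): the coinvariant floor of a cyclic CM field of degree `2m`
  is `(1/2m)Σ_{d | m, d odd} φ(d)2^{m/d} − 1 = 1, 1, 3, 5, 9, 15, 29, 51, 93, 171, 315, …` — André-3's cyclic `μ`-column in closed form.

## References
* [Pohlmann1968] H. Pohlmann, Algebraic cycles on abelian varieties of complex multiplication type, Ann. of Math. 88 (1968), Thm 1.
* [Milne1999] J. S. Milne, Lefschetz motives and the Tate conjecture, Compositio Math. 117 (1999), Prop. 2.1, p. 54.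
-/

noncomputable section

open NumberField NumberField.ComplexEmbedding

namespace Summit.HodgeConjecture.CorCM.FaceCoinvariant

open Literature.AlgebraicGeometry.Motives (CMType)
open Summit.HodgeConjecture.CorCM.Prior.AllgGroup.RfwfAllgGroup
open Summit.HodgeConjecture.CorCM.Census.BlockParity
open Summit.HodgeConjecture.CorCM.Census.Coinvariant

variable {F : Type} [Field F] [NumberField F]

/-! ## §1 Dictionary: pairs, and reads of faces are Hodge vectors -/

/-- **The pair relations of `F` are the pairs of part I** (`Ψ̄ = Ψ·conjT`). [folklore] -/
theorem pairRel_eq_span_pairSet [IsCMField F] [IsGalois ℚ F] :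
    (pairRel : Submodule ℤ (CMF (GalT F) conjT →₀ ℤ)) = Submodule.span ℤ (pairSet (conjT : GalT F)) := by
  unfold pairRel
  congr 1
  ext y
  constructor
  · rintro ⟨Ψ, rfl⟩
    refine ⟨Ψ, ?_⟩
    rw [pair, ← FaceParity.barCM_eq_rt]
  · rintro ⟨Ψ, rfl⟩
    refine ⟨Ψ, ?_⟩
    rw [pair, ← FaceParity.barCM_eq_rt]

/-- **The type sum of the `σ`-read of a face is the constant `2`** (rfwf Lemma 1.2: the Weil weight of a face is of Hodge type `(2,2)`).
[folklore] -/
theorem typeSum_weightRel_corner (g : Face F) (σ : F →+* ℂ) (t : GalT F) :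
    typeSum (GalT F) conjT (weightRel g.corner (fun _ => ({σ} : Finset (F →+* ℂ)))) t = 2 := by
  simp only [weightRel, map_sum, Finset.sum_apply, Finset.sum_singleton, typeSum_single_pullType]
  rw [Fin.sum_univ_four]
  exact sumTwo_corner g (t.1 σ)

/-- **Reads of faces are integer Hodge vectors**: `weightRel g.corner (· ↦ {σ}) ∈ hodgeSpan = ℤ⟨faces⟩ + ℤ⟨pairs⟩`. [folklore] -/
theorem weightRel_corner_mem_hodgeSpan [IsCMField F] [IsGalois ℚ F] (g : Face F) (σ : F →+* ℂ) :
    weightRel g.corner (fun _ => ({σ} : Finset (F →+* ℂ))) ∈ hodgeSpan (conjT : GalT F) conjT_mul_self :=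
  mem_hodgeSpan_of_forall_typeSum_eq conjT conjT_mul_self conjT_ne_one (fun P => FaceBasis.conjT_comm P)
    (typeSum_weightRel_corner g σ)

/-! ## §2 The face-coinvariant floor -/

/-- **THE FACE-COINVARIANT FLOOR.**  For a Galois CM field `F` and ANY finite set `𝒮` of faces satisfying the generation binder
`hgen(𝒮, σ₀)` of INT2-GEN: **`φ₂(F) ≤ |𝒮|`**, where `φ₂(F) = dim_𝔽₂ (Λ_F ⊗ 𝔽₂)_{Gal}` is the coinvariant fibre of the Hodge lattice of
`F` modulo pairs — no census, no certificate, every degree and every Galois type. [folklore] -/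
theorem fibreTwo_le_card_of_hgen [IsCMField F] [IsGalois ℚ F] (𝒮 : Finset (Face F)) (σ₀ : F →+* ℂ)
    (hgen : ∀ f : Face F, lefChar f.corner (fun _ => ({σ₀} : Finset (F →+* ℂ))) ∈ AddSubgroup.closure
      {a : Asym F | ∃ g ∈ (𝒮 : Set (Face F)), ∃ σ : F →+* ℂ, a = lefChar g.corner (fun _ => ({σ} : Finset (F →+* ℂ)))}) :
    fibreTwo (conjT : GalT F) conjT_mul_self ≤ 𝒮.card := by
  classical
  have hS : ((𝒮.image fun g : Face F => weightRel g.corner (fun _ => ({σ₀} : Finset (F →+* ℂ))) :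
      Finset (CMF (GalT F) conjT →₀ ℤ)) : Set (CMF (GalT F) conjT →₀ ℤ)) ⊆ hodgeSpan (conjT : GalT F) conjT_mul_self := by
    intro y hy
    obtain ⟨g, -, rfl⟩ := Finset.mem_image.mp (Finset.mem_coe.mp hy)
    exact weightRel_corner_mem_hodgeSpan g σ₀
  have h := fibreTwo_le_card conjT conjT_mul_self (fun P => FaceBasis.conjT_comm P)
    (𝒮.image fun g : Face F => weightRel g.corner (fun _ => ({σ₀} : Finset (F →+* ℂ)))) pairRel
    (le_of_eq pairRel_eq_span_pairSet) hS (FaceParity.gfaceSet_subset_of_hgen 𝒮 σ₀ hgen)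
  exact h.trans Finset.card_image_le

/-! ## §3 Domination of the parity floor -/

/-- **`β(F) ≤ φ₂(F) + 1 + δ(F)`**: the parity floor (`FaceParityFloor.card_block_le_card_add_of_hgen`) is a corollary of the coinvariant
floor; `φ₂(F)` is strictly larger on the «divided parity» Galois types (`Q₈`, `Q₁₆`, `SD₁₆`, `M₁₆`, `ℤ/4×ℤ/2` with `c ∈ 2G`, …).
[folklore] -/
theorem card_block_le_fibreTwo_add [IsCMField F] [IsGalois ℚ F] (T₀ : CMF (GalT F) conjT) :
    Fintype.card (Block (conjT : GalT F)) ≤ fibreTwo (conjT : GalT F) conjT_mul_self + 1 + wdelta (conjT : GalT F) T₀ :=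
  Census.Coinvariant.card_block_le_fibreTwo_add conjT conjT_mul_self T₀

/-- `δ`-free form: `β(F) ≤ φ₂(F) + 2`. [folklore] -/
theorem card_block_le_fibreTwo_add_two [IsCMField F] [IsGalois ℚ F] :
    Fintype.card (Block (conjT : GalT F)) ≤ fibreTwo (conjT : GalT F) conjT_mul_self + 2 :=
  Census.Coinvariant.card_block_le_fibreTwo_add_two conjT conjT_mul_self conjT_ne_one

/-- **The exact strength of ALL base-change-invariant mod-2 functionals on the Hodge lattice of `F`**: `dim_𝔽₂ span par(faces) ≤ φ₂(F)`.
[folklore] -/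
theorem finrank_span_par_le_fibreTwo [IsCMField F] [IsGalois ℚ F] :
    Module.finrank (ZMod 2) ↥(Submodule.span (ZMod 2) (par (conjT : GalT F) '' gfaceSet (GalT F) conjT conjT_mul_self)) ≤
      fibreTwo (conjT : GalT F) conjT_mul_self :=
  Census.Coinvariant.finrank_span_par_le_fibreTwo conjT conjT_mul_self

/-! ## §4 Galois CM fields of `2`-power degree: the floor is attained mod `2` by faces -/

/-- A Galois CM field of degree `2^k` has a `2`-group of Galois translates. [folklore] -/
theorem isPGroup_galT_of_finrank_eq_two_pow [IsGalois ℚ F] {k : ℕ} (hk : Module.finrank ℚ F = 2 ^ k) :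
    IsPGroup 2 (GalT F) :=
  isPGroup_two_of_card (by rw [FaceCensus.card_galT, hk])

/-- **`2`-power degree: `φ₂(F)` faces generate mod `2`.**  If `[F:ℚ] = 2^k`, there are `φ₂(F)` abstract faces mod `2` whose base
changes, together with the pairs, span the whole Hodge lattice of `F` mod `2` (part III, `p`-group Nakayama): the coinvariant floor is
attained mod `2`, by faces. [folklore] -/
theorem exists_faces_generate_of_finrank_eq_two_pow [IsCMField F] [IsGalois ℚ F] {k : ℕ} (hk : Module.finrank ℚ F = 2 ^ k) :
    ∃ S : Finset (CMF (GalT F) conjT →₀ ZMod 2), ↑S ⊆ faces2 (conjT : GalT F) conjT_mul_self ∧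
      S.card = fibreTwo (conjT : GalT F) conjT_mul_self ∧
      hodge2 (conjT : GalT F) conjT_mul_self ≤ pair2 (conjT : GalT F) ⊔ Submodule.span (ZMod 2) (translates2 conjT S) :=
  exists_faces_generate_of_isPGroup conjT (isPGroup_galT_of_finrank_eq_two_pow hk) conjT_mul_self
    (fun P => FaceBasis.conjT_comm P)

/-- **`2`-power degree: `φ₂(F)` is the least number of Hodge generators mod `2`**, attained by faces. [folklore] -/
theorem isLeast_fibreTwo_of_finrank_eq_two_pow [IsCMField F] [IsGalois ℚ F] {k : ℕ} (hk : Module.finrank ℚ F = 2 ^ k) :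
    IsLeast {n : ℕ | ∃ S : Finset (CMF (GalT F) conjT →₀ ZMod 2),
      (S : Set (CMF (GalT F) conjT →₀ ZMod 2)) ⊆ hodge2 (conjT : GalT F) conjT_mul_self ∧ S.card = n ∧
      faces2 (conjT : GalT F) conjT_mul_self ⊆
        ↑(pair2 (conjT : GalT F) ⊔ Submodule.span (ZMod 2) (translates2 conjT S))}
      (fibreTwo (conjT : GalT F) conjT_mul_self) :=
  isLeast_fibreTwo_of_isPGroup conjT (isPGroup_galT_of_finrank_eq_two_pow hk) conjT_mul_self
    (fun P => FaceBasis.conjT_comm P)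

/-! ## §5 Cyclic Galois groups: `φ₂(F) = β(F) − 1` -/

/-- **Cyclic Galois group: `φ₂(F) + 1 = β(F)`** — the coinvariant floor and the parity floor coincide and equal the number of blocks
minus one (part VI). [folklore] -/
theorem fibreTwo_add_one_eq_card_block_of_isCyclic [IsCMField F] [IsGalois ℚ F] [IsCyclic (GalT F)] :
    fibreTwo (conjT : GalT F) conjT_mul_self + 1 = Fintype.card (Block (conjT : GalT F)) :=
  Census.Coinvariant.fibreTwo_add_one_eq_card_block_of_isCyclic conjT conjT_mul_self conjT_ne_one

/-- **Cyclic Galois group, closed form**: `(φ₂(F) + 1)·[F:ℚ] = Σ_{d ∣ [F:ℚ], d odd} φ(d)·2^{[F:ℚ]/2/d}`. [folklore] -/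
theorem fibreTwo_add_one_mul_finrank_of_isCyclic [IsCMField F] [IsGalois ℚ F] [IsCyclic (GalT F)] :
    (fibreTwo (conjT : GalT F) conjT_mul_self + 1) * Module.finrank ℚ F =
      ∑ d ∈ (Module.finrank ℚ F).divisors with Odd d, Nat.totient d * 2 ^ (Module.finrank ℚ F / 2 / d) := by
  rw [← FaceCensus.card_galT (F := F)]
  exact Census.Coinvariant.fibreTwo_add_one_mul_card_of_isCyclic conjT conjT_mul_self conjT_ne_one

end Summit.HodgeConjecture.CorCM.FaceCoinvariant

end
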